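import Mathlib

/-!
# The clique units die by (V) at depth 1 — LEMMAS D(b) and E of «S2-21» (pub-hsemireg, S4-PUSH corner 2)

Fourth part of the kernel leg of seat s4-search-2 gen 13 (cell `pub-hsemireg`) for §5 of
`s4push/search-2/g11/LIFT2-search-2-g11.md`; companions `TwoSlotFrameTable.lean` (atom tables),
`DegreeSixSecondDigit.lean` (the edge unit: LEMMAS A(a), B, D(a)), `MixedFrameLeadingDigit.lean` (LEMMA A(b)).
Here: the units of the M2 decision whose leading digit is a CLIQUE SUM `B₀ = P₁ := Σ_{i∈S} hᵢ` — LEMMA D(b) (`q =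
4`, `m = 2`; dual types `(2,2,2,2,3,5)`, `(2,2,2,2,4,4)` with `S` = slots `0–3`, `(2,2,2,3,3,4)` with `S` = slots
`0–2`; 222 units of record) and LEMMA E (`q = 2`, `m = 1`, the (S3) units; types `(1,1,1,1,2,2)`, `(1,1,1,1,1,3)`,
`(1,1,1,1,1,2)`, `(1,1,1,1,1,1)`, `S = {i : c′ᵢ = 1}`; 56 units of record).  Of record these kills were machine ×2
(g10 `tight3`, g11 `lift2`) + pencil (memo §5 D(b)∕E) + the standalone by-definition script `verify_lemmaDE.py`;
here the displayed coefficient computations become ring identities checked by the kernel.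

**Setting** (CRITERION L digit tower at `p = 2`; `Λ^{ev} = ⊕Λ^{2k}ℤ¹²` commutative and torsion-free, `hᵢ =
x_{2i}x_{2i+1}`; coefficients in `ℤ₍₂₎` where a signature is not integral).  Atoms: the clique sums `P_k := e_k(hᵢ
: i ∈ S)` (`k = 1, 2, 3`; `P₂ = P₁^[2]`, `P₃ = P₁^[3]`) with the divided-power law `P₁P₁ = 2P₂`, `P₁P₂ = 3P₃`
(`TwoSlotFrameTable.slotSum_11∕_12` for four slots, `cliqueSum_*` there for 3∕5∕6 slots), and the outside slots
`hⱼ` (`hⱼ² = 0`) with their weights `2^{c′ⱼ}`; `D = 2^{c_S}P₁ + Σ_{j∉S} 2^{c′ⱼ}hⱼ` and its divided powers `D₂`,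
`D₃` in closed form (pinned by `pin_D_*`: `D·D = 2D₂`, `D·D·D = 6D₃`).  Registered `T₃(B) = σ₃D^[3] − qσ₂D^[2]B +
q²σ₁DB^[2] − q³σ₀B^[3]` and depth-1 bound terms `K₃,₁(B) = −qσ₂D^[2] + q²σ₁DB − q³σ₀B^[2]`, `K₃,₂(B) = q²σ₁D −
q³σ₀B`, `K₃,₃ = −q³σ₀` (PREREG-S2-19 §1 ∕ memo §1 (b)); the data satisfy `σ₁ = 0`, `σ₀ = 2s + 1`, `σ₂ = 4t − σ₀`,
`σ₃ = 4u`.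

**Proved, per type** (`T3_*`, `K31_*`, `pin_D_*`): `T₃(P₁) = 2^v·(2s + 2u + 1 − 6t)·P₃ + 2^{v′}·(terms each
containing an outside slot)` with `(v, v′) = (7, 8)` for D(b) and `(4, 4)` for E, and `K₃,₁(P₁) = 2^v·(explicit)`.
Reading in `Λ^{ev}`: the clique triples `hᵢhⱼh_k` (`i<j<k ∈ S`) are basis 6-vectors distinct from every monomial
with an outside slot, so `v₂(T₃(P₁)) = v` exactly (`2s + 2u + 1 − 6t` odd — the memo's `−64(σ₀ + 3σ₂ − σ₃)` resp.
`−8(σ₀ + 3σ₂ − σ₃)` coefficient), while the (V) bound at depth 1 is `g₃ = min(m(2k−1), 1 + v₂(K₃,₁), 2 + v₂(K₃,₂),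
3 + v₂(K₃,₃)) = v + 1` (`K₃,₂ = −q³σ₀P₁` has `v₂ = 6` resp. `3`; `K₃,₁` contributes `≥ v + 1` by `K31_*`): `v <
g₃`, no remainder `Z` can repair `T₃(P₁ + 2Z) ≡ 0 mod 2^{m(2k−1)}` — the unit is CLASS-DEAD, the memo's `(k, v, g)
= (3, 7, 8)` resp. `(3, 4, 5)` (machine: all 222 resp. 56 units, `verify_lemmaDE.py` PASS on the 14 signatures).

Proofs: `linear_combination` with explicit cofactors (generator `s4push/search-2/g13/cert/gen5.py`, stdlib only;
every divisibility exponent above is asserted there before printing).  Scope ∕ honest framing as in the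
companions: elementary commutative algebra, theorems only (count-neutral); a kernel check of pencil steps of a
CLASS-LEVEL necessary-condition sieve at the special fibre `E⁶`; not the tower framework itself, not LEMMA C, not
the E = ∅ dimension-0 units; no object, no `σ` computation, no Hodge statement; nothing here bears on HC ∕ HC_CM ∕
HC_AV.
-/

namespace Summit.Ventures.HSemireg.CliqueUnitKills

variable {R : Type*} [CommRing R]

/-! ### 1. LEMMAS D(b) and E: `T₃(P₁)`, the bound term `K₃,₁`, and the pinning of `D₂, D₃`, per unit type -/

/-- **D(b), type (2,2,2,2,3,5), S = slots 0–3.** Pinning: with `D = 4 * P₁ + 8 * h₄ + 32 * h₅` (clique sum `P₁ =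
Σ_{i∈S} hᵢ` with divided powers `P₂, P₃`: `P₁P₁ = 2P₂`, `P₁P₂ = 3P₃`; outside slots square to `0`), the
closed forms `D₂`, `D₃` below are `D^[2]`, `D^[3]`: `D·D = 2D₂` and `D·D·D = 6D₃`. -/
theorem pin_D_Km2235 (h₄ h₅ P₁ P₂ P₃ D D₂ D₃ : R) (hD : D = 4 * P₁ + 8 * h₄ + 32 * h₅) (hD₂ : D₂ =
    (256) * h₄ * h₅ + (128) * P₁ * h₅ + (32) * P₁ * h₄ + (16) * P₂) (hD₃ : D₃ = (1024) * P₁ * h₄ *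
    h₅ + (512) * P₂ * h₅ + (128) * P₂ * h₄ + (64) * P₃) (qP₁₁ : P₁ * P₁ = 2 * P₂) (qP₁₂ : P₁ * P₂ =
    3 * P₃) (qh₄ : h₄ * h₄ = 0) (qh₅ : h₅ * h₅ = 0) :
    D * D = 2 * D₂ ∧ D * D * D = 6 * D₃ := by
  refine ⟨?_, ?_⟩
  · linear_combination ((32) * h₅ + (8) * h₄ + (4) * P₁ + D) * hD + ((-2)) * hD₂ + (16) * qP₁₁ +
      (64) * qh₄ + (1024) * qh₅
  · linear_combination ((1024) * h₅ ^ 2 + (512) * h₄ * h₅ + (64) * h₄ ^ 2 + (256) * P₁ * h₅ + (64) *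
      P₁ * h₄ + (16) * P₁ ^ 2 + (32) * D * h₅ + (8) * D * h₄ + (4) * D * P₁ + D ^ 2) * hD + ((-6)) *
      hD₃ + ((1536) * h₅ + (384) * h₄ + (64) * P₁) * qP₁₁ + (128) * qP₁₂ + ((6144) * h₅ + (512) * h₄
      + (768) * P₁) * qh₄ + ((32768) * h₅ + (24576) * h₄ + (12288) * P₁) * qh₅

/-- **LEMMA D(b), type (2,2,2,2,3,5), S = slots 0–3: the leading digit `B₀ = P₁` dies by (V) at depth 1.** `σ₁ =
0`, `σ₀ = 2s + 1`, `σ₂ = 4t − σ₀`, `σ₃ = 4u`; `T₃(P₁) = σ₃D^[3] − 4σ₂D^[2]P₁ + 16σ₁DP₁^[2] − 64σ₀P₁^[3]`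
equals `2^7·(2s + 2u + 1 − 6t)·P₃ + 256·(terms each containing an outside slot)`: every clique triple
`hᵢhⱼh_k` (`i<j<k ∈ S`) has coefficient `2^7`·odd and every other basis 6-vector a coefficient divisible by
`256`, so `v₂(T₃(P₁)) = 7 < 8 = g₃` — the memo's `(k, v, g) = (3, 7, 8)` kill. -/
theorem T3_Km2235 (h₄ h₅ σ₀ σ₁ σ₂ σ₃ s t u P₁ P₂ P₃ D D₂ D₃ T₃ : R) (hT₃ : T₃ = σ₃ * D₃ - 4 * σ₂ *
    (D₂ * P₁) + 16 * σ₁ * (D * P₂) - 64 * σ₀ * P₃) (hD : D = 4 * P₁ + 8 * h₄ + 32 * h₅) (hD₂ : D₂ =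
    (256) * h₄ * h₅ + (128) * P₁ * h₅ + (32) * P₁ * h₄ + (16) * P₂) (hD₃ : D₃ = (1024) * P₁ * h₄ *
    h₅ + (512) * P₂ * h₅ + (128) * P₂ * h₄ + (64) * P₃) (qP₁₁ : P₁ * P₁ = 2 * P₂) (qP₁₂ : P₁ * P₂ =
    3 * P₃) (hσ₁ : σ₁ = 0) (hσ₂ : σ₂ = 4 * t - σ₀) (hσ₀ : σ₀ = 2 * s + 1) (hσ₃ : σ₃ = 4 * u) :
    T₃ = 128 * ((2 * s + 2 * u + 1 - 6 * t) * P₃) + 256 * ((4) * P₁ * h₄ * h₅ + (16) * P₁ * h₄ * h₅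
      * u + (-16) * P₁ * h₄ * h₅ * t + (8) * P₁ * h₄ * h₅ * s + (4) * P₂ * h₅ + (8) * P₂ * h₅ * u +
      (-16) * P₂ * h₅ * t + (8) * P₂ * h₅ * s + P₂ * h₄ + (2) * P₂ * h₄ * u + (-4) * P₂ * h₄ * t +
      (2) * P₂ * h₄ * s) := by
  linear_combination (1) * hT₃ + ((16) * P₂ * σ₁) * hD + ((-4) * P₁ * σ₂) * hD₂ + (σ₃) * hD₃ +
    ((-512) * h₅ * σ₂ + (-128) * h₄ * σ₂) * qP₁₁ + ((-64) * σ₂ + (64) * σ₁) * qP₁₂ + ((512) * P₂ *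
    h₅ + (128) * P₂ * h₄ + (192) * P₃) * hσ₁ + ((-1024) * P₁ * h₄ * h₅ + (-1024) * P₂ * h₅ + (-256)
    * P₂ * h₄ + (-192) * P₃) * hσ₂ + ((1024) * P₁ * h₄ * h₅ + (1024) * P₂ * h₅ + (256) * P₂ * h₄ +
    (128) * P₃) * hσ₀ + ((1024) * P₁ * h₄ * h₅ + (512) * P₂ * h₅ + (128) * P₂ * h₄ + (64) * P₃) *
    hσ₃

/-- The depth-1 bound (type (2,2,2,2,3,5), S = slots 0–3): `K₃,₁(P₁) = −4σ₂D^[2] + 16σ₁DP₁ − 64σ₀P₁^[2] =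
128·(explicit)`, so `1 + v₂(K₃,₁) ≥ 8`; with `2 + v₂(K₃,₂) = 2 + v₂(−64σ₀P₁) = 8` and `3 + v₂(K₃,₃) = 3 +
v₂(−64σ₀) = 9` the (V) bound is `g₃ = min(10, …) = 8`. -/
theorem K31_Km2235 (h₄ h₅ σ₀ σ₁ σ₂ s t P₁ P₂ D D₂ K₃₁ : R) (hK₃₁ : K₃₁ = -4 * σ₂ * D₂ + 16 * σ₁ * (D
    * P₁) - 64 * σ₀ * P₂) (hD : D = 4 * P₁ + 8 * h₄ + 32 * h₅) (hD₂ : D₂ = (256) * h₄ * h₅ + (128) *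
    P₁ * h₅ + (32) * P₁ * h₄ + (16) * P₂) (qP₁₁ : P₁ * P₁ = 2 * P₂) (hσ₁ : σ₁ = 0) (hσ₂ : σ₂ = 4 * t
    - σ₀) (hσ₀ : σ₀ = 2 * s + 1) :
    K₃₁ = 128 * ((8) * h₄ * h₅ + (-32) * h₄ * h₅ * t + (16) * h₄ * h₅ * s + (4) * P₁ * h₅ + (-16) *
      P₁ * h₅ * t + (8) * P₁ * h₅ * s + P₁ * h₄ + (-4) * P₁ * h₄ * t + (2) * P₁ * h₄ * s + (-2) * P₂
      * t) := by
  linear_combination (1) * hK₃₁ + ((16) * P₁ * σ₁) * hD + ((-4) * σ₂) * hD₂ + ((64) * σ₁) * qP₁₁ +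
    ((512) * P₁ * h₅ + (128) * P₁ * h₄ + (128) * P₂) * hσ₁ + ((-1024) * h₄ * h₅ + (-512) * P₁ * h₅ +
    (-128) * P₁ * h₄ + (-64) * P₂) * hσ₂ + ((1024) * h₄ * h₅ + (512) * P₁ * h₅ + (128) * P₁ * h₄) *
    hσ₀

/-- **D(b), type (2,2,2,2,4,4), S = slots 0–3.** Pinning: with `D = 4 * P₁ + 16 * h₄ + 16 * h₅` (clique sum `P₁
= Σ_{i∈S} hᵢ` with divided powers `P₂, P₃`: `P₁P₁ = 2P₂`, `P₁P₂ = 3P₃`; outside slots square to `0`), the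
closed forms `D₂`, `D₃` below are `D^[2]`, `D^[3]`: `D·D = 2D₂` and `D·D·D = 6D₃`. -/
theorem pin_D_Km2244 (h₄ h₅ P₁ P₂ P₃ D D₂ D₃ : R) (hD : D = 4 * P₁ + 16 * h₄ + 16 * h₅) (hD₂ : D₂ =
    (256) * h₄ * h₅ + (64) * P₁ * h₅ + (64) * P₁ * h₄ + (16) * P₂) (hD₃ : D₃ = (1024) * P₁ * h₄ * h₅
    + (256) * P₂ * h₅ + (256) * P₂ * h₄ + (64) * P₃) (qP₁₁ : P₁ * P₁ = 2 * P₂) (qP₁₂ : P₁ * P₂ = 3 *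
    P₃) (qh₄ : h₄ * h₄ = 0) (qh₅ : h₅ * h₅ = 0) :
    D * D = 2 * D₂ ∧ D * D * D = 6 * D₃ := by
  refine ⟨?_, ?_⟩
  · linear_combination ((16) * h₅ + (16) * h₄ + (4) * P₁ + D) * hD + ((-2)) * hD₂ + (16) * qP₁₁ +
      (256) * qh₄ + (256) * qh₅
  · linear_combination ((256) * h₅ ^ 2 + (512) * h₄ * h₅ + (256) * h₄ ^ 2 + (128) * P₁ * h₅ + (128)
      * P₁ * h₄ + (16) * P₁ ^ 2 + (16) * D * h₅ + (16) * D * h₄ + (4) * D * P₁ + D ^ 2) * hD +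
      ((-6)) * hD₃ + ((768) * h₅ + (768) * h₄ + (64) * P₁) * qP₁₁ + (128) * qP₁₂ + ((12288) * h₅ +
      (4096) * h₄ + (3072) * P₁) * qh₄ + ((4096) * h₅ + (12288) * h₄ + (3072) * P₁) * qh₅

/-- **LEMMA D(b), type (2,2,2,2,4,4), S = slots 0–3:** the same identity shape — `T₃(P₁) = 2^7·(2s + 2u + 1 −
6t)·P₃ + 256·(outside terms)`, `v₂(T₃(P₁)) = 7 < 8`. -/
theorem T3_Km2244 (h₄ h₅ σ₀ σ₁ σ₂ σ₃ s t u P₁ P₂ P₃ D D₂ D₃ T₃ : R) (hT₃ : T₃ = σ₃ * D₃ - 4 * σ₂ *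
    (D₂ * P₁) + 16 * σ₁ * (D * P₂) - 64 * σ₀ * P₃) (hD : D = 4 * P₁ + 16 * h₄ + 16 * h₅) (hD₂ : D₂ =
    (256) * h₄ * h₅ + (64) * P₁ * h₅ + (64) * P₁ * h₄ + (16) * P₂) (hD₃ : D₃ = (1024) * P₁ * h₄ * h₅
    + (256) * P₂ * h₅ + (256) * P₂ * h₄ + (64) * P₃) (qP₁₁ : P₁ * P₁ = 2 * P₂) (qP₁₂ : P₁ * P₂ = 3 *
    P₃) (hσ₁ : σ₁ = 0) (hσ₂ : σ₂ = 4 * t - σ₀) (hσ₀ : σ₀ = 2 * s + 1) (hσ₃ : σ₃ = 4 * u) :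
    T₃ = 128 * ((2 * s + 2 * u + 1 - 6 * t) * P₃) + 256 * ((4) * P₁ * h₄ * h₅ + (16) * P₁ * h₄ * h₅
      * u + (-16) * P₁ * h₄ * h₅ * t + (8) * P₁ * h₄ * h₅ * s + (2) * P₂ * h₅ + (4) * P₂ * h₅ * u +
      (-8) * P₂ * h₅ * t + (4) * P₂ * h₅ * s + (2) * P₂ * h₄ + (4) * P₂ * h₄ * u + (-8) * P₂ * h₄ *
      t + (4) * P₂ * h₄ * s) := by
  linear_combination (1) * hT₃ + ((16) * P₂ * σ₁) * hD + ((-4) * P₁ * σ₂) * hD₂ + (σ₃) * hD₃ +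
    ((-256) * h₅ * σ₂ + (-256) * h₄ * σ₂) * qP₁₁ + ((-64) * σ₂ + (64) * σ₁) * qP₁₂ + ((256) * P₂ *
    h₅ + (256) * P₂ * h₄ + (192) * P₃) * hσ₁ + ((-1024) * P₁ * h₄ * h₅ + (-512) * P₂ * h₅ + (-512) *
    P₂ * h₄ + (-192) * P₃) * hσ₂ + ((1024) * P₁ * h₄ * h₅ + (512) * P₂ * h₅ + (512) * P₂ * h₄ +
    (128) * P₃) * hσ₀ + ((1024) * P₁ * h₄ * h₅ + (256) * P₂ * h₅ + (256) * P₂ * h₄ + (64) * P₃) *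
    hσ₃

/-- `K₃,₁(P₁) = 128·(explicit)` (type (2,2,2,2,4,4), S = slots 0–3); `g₃ = 8` as before. -/
theorem K31_Km2244 (h₄ h₅ σ₀ σ₁ σ₂ s t P₁ P₂ D D₂ K₃₁ : R) (hK₃₁ : K₃₁ = -4 * σ₂ * D₂ + 16 * σ₁ * (D
    * P₁) - 64 * σ₀ * P₂) (hD : D = 4 * P₁ + 16 * h₄ + 16 * h₅) (hD₂ : D₂ = (256) * h₄ * h₅ + (64) *
    P₁ * h₅ + (64) * P₁ * h₄ + (16) * P₂) (qP₁₁ : P₁ * P₁ = 2 * P₂) (hσ₁ : σ₁ = 0) (hσ₂ : σ₂ = 4 * t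
    - σ₀) (hσ₀ : σ₀ = 2 * s + 1) :
    K₃₁ = 128 * ((8) * h₄ * h₅ + (-32) * h₄ * h₅ * t + (16) * h₄ * h₅ * s + (2) * P₁ * h₅ + (-8) *
      P₁ * h₅ * t + (4) * P₁ * h₅ * s + (2) * P₁ * h₄ + (-8) * P₁ * h₄ * t + (4) * P₁ * h₄ * s +
      (-2) * P₂ * t) := by
  linear_combination (1) * hK₃₁ + ((16) * P₁ * σ₁) * hD + ((-4) * σ₂) * hD₂ + ((64) * σ₁) * qP₁₁ +
    ((256) * P₁ * h₅ + (256) * P₁ * h₄ + (128) * P₂) * hσ₁ + ((-1024) * h₄ * h₅ + (-256) * P₁ * h₅ +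
    (-256) * P₁ * h₄ + (-64) * P₂) * hσ₂ + ((1024) * h₄ * h₅ + (256) * P₁ * h₅ + (256) * P₁ * h₄) *
    hσ₀

/-- **D(b), type (2,2,2,3,3,4), S = slots 0–2.** Pinning: with `D = 4 * P₁ + 8 * h₃ + 8 * h₄ + 16 * h₅` (clique
sum `P₁ = Σ_{i∈S} hᵢ` with divided powers `P₂, P₃`: `P₁P₁ = 2P₂`, `P₁P₂ = 3P₃`; outside slots square to
`0`), the closed forms `D₂`, `D₃` below are `D^[2]`, `D^[3]`: `D·D = 2D₂` and `D·D·D = 6D₃`. -/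
theorem pin_D_Km2334 (h₃ h₄ h₅ P₁ P₂ P₃ D D₂ D₃ : R) (hD : D = 4 * P₁ + 8 * h₃ + 8 * h₄ + 16 * h₅)
    (hD₂ : D₂ = (128) * h₄ * h₅ + (128) * h₃ * h₅ + (64) * h₃ * h₄ + (64) * P₁ * h₅ + (32) * P₁ * h₄
    + (32) * P₁ * h₃ + (16) * P₂) (hD₃ : D₃ = (1024) * h₃ * h₄ * h₅ + (512) * P₁ * h₄ * h₅ + (512) *
    P₁ * h₃ * h₅ + (256) * P₁ * h₃ * h₄ + (256) * P₂ * h₅ + (128) * P₂ * h₄ + (128) * P₂ * h₃ + (64)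
    * P₃) (qP₁₁ : P₁ * P₁ = 2 * P₂) (qP₁₂ : P₁ * P₂ = 3 * P₃) (qh₃ : h₃ * h₃ = 0) (qh₄ : h₄ * h₄ =
    0) (qh₅ : h₅ * h₅ = 0) :
    D * D = 2 * D₂ ∧ D * D * D = 6 * D₃ := by
  refine ⟨?_, ?_⟩
  · linear_combination ((16) * h₅ + (8) * h₄ + (8) * h₃ + (4) * P₁ + D) * hD + ((-2)) * hD₂ + (16) *
      qP₁₁ + (64) * qh₃ + (64) * qh₄ + (256) * qh₅
  · linear_combination ((256) * h₅ ^ 2 + (256) * h₄ * h₅ + (64) * h₄ ^ 2 + (256) * h₃ * h₅ + (128) *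
      h₃ * h₄ + (64) * h₃ ^ 2 + (128) * P₁ * h₅ + (64) * P₁ * h₄ + (64) * P₁ * h₃ + (16) * P₁ ^ 2 +
      (16) * D * h₅ + (8) * D * h₄ + (8) * D * h₃ + (4) * D * P₁ + D ^ 2) * hD + ((-6)) * hD₃ +
      ((768) * h₅ + (384) * h₄ + (384) * h₃ + (64) * P₁) * qP₁₁ + (128) * qP₁₂ + ((3072) * h₅ +
      (1536) * h₄ + (512) * h₃ + (768) * P₁) * qh₃ + ((3072) * h₅ + (512) * h₄ + (1536) * h₃ + (768)
      * P₁) * qh₄ + ((4096) * h₅ + (6144) * h₄ + (6144) * h₃ + (3072) * P₁) * qh₅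

/-- **LEMMA D(b), type (2,2,2,3,3,4), S = slots 0–2:** the same identity shape — `T₃(P₁) = 2^7·(2s + 2u + 1 −
6t)·P₃ + 256·(outside terms)`, `v₂(T₃(P₁)) = 7 < 8`. -/
theorem T3_Km2334 (h₃ h₄ h₅ σ₀ σ₁ σ₂ σ₃ s t u P₁ P₂ P₃ D D₂ D₃ T₃ : R) (hT₃ : T₃ = σ₃ * D₃ - 4 * σ₂
    * (D₂ * P₁) + 16 * σ₁ * (D * P₂) - 64 * σ₀ * P₃) (hD : D = 4 * P₁ + 8 * h₃ + 8 * h₄ + 16 * h₅)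
    (hD₂ : D₂ = (128) * h₄ * h₅ + (128) * h₃ * h₅ + (64) * h₃ * h₄ + (64) * P₁ * h₅ + (32) * P₁ * h₄
    + (32) * P₁ * h₃ + (16) * P₂) (hD₃ : D₃ = (1024) * h₃ * h₄ * h₅ + (512) * P₁ * h₄ * h₅ + (512) *
    P₁ * h₃ * h₅ + (256) * P₁ * h₃ * h₄ + (256) * P₂ * h₅ + (128) * P₂ * h₄ + (128) * P₂ * h₃ + (64)
    * P₃) (qP₁₁ : P₁ * P₁ = 2 * P₂) (qP₁₂ : P₁ * P₂ = 3 * P₃) (hσ₁ : σ₁ = 0) (hσ₂ : σ₂ = 4 * t - σ₀)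
    (hσ₀ : σ₀ = 2 * s + 1) (hσ₃ : σ₃ = 4 * u) :
    T₃ = 128 * ((2 * s + 2 * u + 1 - 6 * t) * P₃) + 256 * ((16) * h₃ * h₄ * h₅ * u + (2) * P₁ * h₄ *
      h₅ + (8) * P₁ * h₄ * h₅ * u + (-8) * P₁ * h₄ * h₅ * t + (4) * P₁ * h₄ * h₅ * s + (2) * P₁ * h₃
      * h₅ + (8) * P₁ * h₃ * h₅ * u + (-8) * P₁ * h₃ * h₅ * t + (4) * P₁ * h₃ * h₅ * s + P₁ * h₃ *
      h₄ + (4) * P₁ * h₃ * h₄ * u + (-4) * P₁ * h₃ * h₄ * t + (2) * P₁ * h₃ * h₄ * s + (2) * P₂ * h₅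
      + (4) * P₂ * h₅ * u + (-8) * P₂ * h₅ * t + (4) * P₂ * h₅ * s + P₂ * h₄ + (2) * P₂ * h₄ * u +
      (-4) * P₂ * h₄ * t + (2) * P₂ * h₄ * s + P₂ * h₃ + (2) * P₂ * h₃ * u + (-4) * P₂ * h₃ * t +
      (2) * P₂ * h₃ * s) := by
  linear_combination (1) * hT₃ + ((16) * P₂ * σ₁) * hD + ((-4) * P₁ * σ₂) * hD₂ + (σ₃) * hD₃ +
    ((-256) * h₅ * σ₂ + (-128) * h₄ * σ₂ + (-128) * h₃ * σ₂) * qP₁₁ + ((-64) * σ₂ + (64) * σ₁) *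
    qP₁₂ + ((256) * P₂ * h₅ + (128) * P₂ * h₄ + (128) * P₂ * h₃ + (192) * P₃) * hσ₁ + ((-512) * P₁ *
    h₄ * h₅ + (-512) * P₁ * h₃ * h₅ + (-256) * P₁ * h₃ * h₄ + (-512) * P₂ * h₅ + (-256) * P₂ * h₄ +
    (-256) * P₂ * h₃ + (-192) * P₃) * hσ₂ + ((512) * P₁ * h₄ * h₅ + (512) * P₁ * h₃ * h₅ + (256) *
    P₁ * h₃ * h₄ + (512) * P₂ * h₅ + (256) * P₂ * h₄ + (256) * P₂ * h₃ + (128) * P₃) * hσ₀ + ((1024)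
    * h₃ * h₄ * h₅ + (512) * P₁ * h₄ * h₅ + (512) * P₁ * h₃ * h₅ + (256) * P₁ * h₃ * h₄ + (256) * P₂
    * h₅ + (128) * P₂ * h₄ + (128) * P₂ * h₃ + (64) * P₃) * hσ₃

/-- `K₃,₁(P₁) = 128·(explicit)` (type (2,2,2,3,3,4), S = slots 0–2); `g₃ = 8` as before. -/
theorem K31_Km2334 (h₃ h₄ h₅ σ₀ σ₁ σ₂ s t P₁ P₂ D D₂ K₃₁ : R) (hK₃₁ : K₃₁ = -4 * σ₂ * D₂ + 16 * σ₁ *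
    (D * P₁) - 64 * σ₀ * P₂) (hD : D = 4 * P₁ + 8 * h₃ + 8 * h₄ + 16 * h₅) (hD₂ : D₂ = (128) * h₄ *
    h₅ + (128) * h₃ * h₅ + (64) * h₃ * h₄ + (64) * P₁ * h₅ + (32) * P₁ * h₄ + (32) * P₁ * h₃ + (16)
    * P₂) (qP₁₁ : P₁ * P₁ = 2 * P₂) (hσ₁ : σ₁ = 0) (hσ₂ : σ₂ = 4 * t - σ₀) (hσ₀ : σ₀ = 2 * s + 1) :
    K₃₁ = 128 * ((4) * h₄ * h₅ + (-16) * h₄ * h₅ * t + (8) * h₄ * h₅ * s + (4) * h₃ * h₅ + (-16) *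
      h₃ * h₅ * t + (8) * h₃ * h₅ * s + (2) * h₃ * h₄ + (-8) * h₃ * h₄ * t + (4) * h₃ * h₄ * s + (2)
      * P₁ * h₅ + (-8) * P₁ * h₅ * t + (4) * P₁ * h₅ * s + P₁ * h₄ + (-4) * P₁ * h₄ * t + (2) * P₁ *
      h₄ * s + P₁ * h₃ + (-4) * P₁ * h₃ * t + (2) * P₁ * h₃ * s + (-2) * P₂ * t) := by
  linear_combination (1) * hK₃₁ + ((16) * P₁ * σ₁) * hD + ((-4) * σ₂) * hD₂ + ((64) * σ₁) * qP₁₁ +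
    ((256) * P₁ * h₅ + (128) * P₁ * h₄ + (128) * P₁ * h₃ + (128) * P₂) * hσ₁ + ((-512) * h₄ * h₅ +
    (-512) * h₃ * h₅ + (-256) * h₃ * h₄ + (-256) * P₁ * h₅ + (-128) * P₁ * h₄ + (-128) * P₁ * h₃ +
    (-64) * P₂) * hσ₂ + ((512) * h₄ * h₅ + (512) * h₃ * h₅ + (256) * h₃ * h₄ + (256) * P₁ * h₅ +
    (128) * P₁ * h₄ + (128) * P₁ * h₃) * hσ₀

/-- **E, type (1,1,1,1,2,2), S = slots 0–3 (m = 1, q = 2).** Pinning: with `D = 2 * P₁ + 4 * h₄ + 4 * h₅`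
(clique sum `P₁ = Σ_{i∈S} hᵢ` with divided powers `P₂, P₃`: `P₁P₁ = 2P₂`, `P₁P₂ = 3P₃`; outside slots square
to `0`), the closed forms `D₂`, `D₃` below are `D^[2]`, `D^[3]`: `D·D = 2D₂` and `D·D·D = 6D₃`. -/
theorem pin_D_Km1122 (h₄ h₅ P₁ P₂ P₃ D D₂ D₃ : R) (hD : D = 2 * P₁ + 4 * h₄ + 4 * h₅) (hD₂ : D₂ =
    (16) * h₄ * h₅ + (8) * P₁ * h₅ + (8) * P₁ * h₄ + (4) * P₂) (hD₃ : D₃ = (32) * P₁ * h₄ * h₅ +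
    (16) * P₂ * h₅ + (16) * P₂ * h₄ + (8) * P₃) (qP₁₁ : P₁ * P₁ = 2 * P₂) (qP₁₂ : P₁ * P₂ = 3 * P₃)
    (qh₄ : h₄ * h₄ = 0) (qh₅ : h₅ * h₅ = 0) :
    D * D = 2 * D₂ ∧ D * D * D = 6 * D₃ := by
  refine ⟨?_, ?_⟩
  · linear_combination ((4) * h₅ + (4) * h₄ + (2) * P₁ + D) * hD + ((-2)) * hD₂ + (4) * qP₁₁ + (16)
      * qh₄ + (16) * qh₅
  · linear_combination ((16) * h₅ ^ 2 + (32) * h₄ * h₅ + (16) * h₄ ^ 2 + (16) * P₁ * h₅ + (16) * P₁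
      * h₄ + (4) * P₁ ^ 2 + (4) * D * h₅ + (4) * D * h₄ + (2) * D * P₁ + D ^ 2) * hD + ((-6)) * hD₃
      + ((48) * h₅ + (48) * h₄ + (8) * P₁) * qP₁₁ + (16) * qP₁₂ + ((192) * h₅ + (64) * h₄ + (96) *
      P₁) * qh₄ + ((64) * h₅ + (192) * h₄ + (96) * P₁) * qh₅

/-- **LEMMA E, type (1,1,1,1,2,2), S = slots 0–3 (m = 1, q = 2): the leading digit `B₀ = P₁` dies by (V) at
depth 1.** `σ₁ = 0`, `σ₀ = 2s + 1`, `σ₂ = 4t − σ₀`, `σ₃ = 4u`; `T₃(P₁) = σ₃D^[3] − 2σ₂D^[2]P₁ + 4σ₁DP₁^[2] −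
8σ₀P₁^[3]` equals `2^4·(2s + 2u + 1 − 6t)·P₃ + 16·(terms each containing an outside slot)`: every clique
triple `hᵢhⱼh_k` (`i<j<k ∈ S`) has coefficient `2^4`·odd and every other basis 6-vector a coefficient
divisible by `16`, so `v₂(T₃(P₁)) = 4 < 5 = g₃` — the memo's `(k, v, g) = (3, 4, 5)` kill. -/
theorem T3_Km1122 (h₄ h₅ σ₀ σ₁ σ₂ σ₃ s t u P₁ P₂ P₃ D D₂ D₃ T₃ : R) (hT₃ : T₃ = σ₃ * D₃ - 2 * σ₂ *
    (D₂ * P₁) + 4 * σ₁ * (D * P₂) - 8 * σ₀ * P₃) (hD : D = 2 * P₁ + 4 * h₄ + 4 * h₅) (hD₂ : D₂ =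
    (16) * h₄ * h₅ + (8) * P₁ * h₅ + (8) * P₁ * h₄ + (4) * P₂) (hD₃ : D₃ = (32) * P₁ * h₄ * h₅ +
    (16) * P₂ * h₅ + (16) * P₂ * h₄ + (8) * P₃) (qP₁₁ : P₁ * P₁ = 2 * P₂) (qP₁₂ : P₁ * P₂ = 3 * P₃)
    (hσ₁ : σ₁ = 0) (hσ₂ : σ₂ = 4 * t - σ₀) (hσ₀ : σ₀ = 2 * s + 1) (hσ₃ : σ₃ = 4 * u) :
    T₃ = 16 * ((2 * s + 2 * u + 1 - 6 * t) * P₃) + 16 * ((2) * P₁ * h₄ * h₅ + (8) * P₁ * h₄ * h₅ * u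
      + (-8) * P₁ * h₄ * h₅ * t + (4) * P₁ * h₄ * h₅ * s + (2) * P₂ * h₅ + (4) * P₂ * h₅ * u + (-8)
      * P₂ * h₅ * t + (4) * P₂ * h₅ * s + (2) * P₂ * h₄ + (4) * P₂ * h₄ * u + (-8) * P₂ * h₄ * t +
      (4) * P₂ * h₄ * s) := by
  linear_combination (1) * hT₃ + ((4) * P₂ * σ₁) * hD + ((-2) * P₁ * σ₂) * hD₂ + (σ₃) * hD₃ + ((-16)
    * h₅ * σ₂ + (-16) * h₄ * σ₂) * qP₁₁ + ((-8) * σ₂ + (8) * σ₁) * qP₁₂ + ((16) * P₂ * h₅ + (16) *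
    P₂ * h₄ + (24) * P₃) * hσ₁ + ((-32) * P₁ * h₄ * h₅ + (-32) * P₂ * h₅ + (-32) * P₂ * h₄ + (-24) *
    P₃) * hσ₂ + ((32) * P₁ * h₄ * h₅ + (32) * P₂ * h₅ + (32) * P₂ * h₄ + (16) * P₃) * hσ₀ + ((32) *
    P₁ * h₄ * h₅ + (16) * P₂ * h₅ + (16) * P₂ * h₄ + (8) * P₃) * hσ₃

/-- The depth-1 bound (type (1,1,1,1,2,2), S = slots 0–3 (m = 1, q = 2)): `K₃,₁(P₁) = −2σ₂D^[2] + 4σ₁DP₁ −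
8σ₀P₁^[2] = 16·(explicit)`, so `1 + v₂(K₃,₁) ≥ 5`; with `2 + v₂(K₃,₂) = 2 + v₂(−8σ₀P₁) = 5` and `3 +
v₂(K₃,₃) = 3 + v₂(−8σ₀) = 6` the (V) bound is `g₃ = min(5, …) = 5`. -/
theorem K31_Km1122 (h₄ h₅ σ₀ σ₁ σ₂ s t P₁ P₂ D D₂ K₃₁ : R) (hK₃₁ : K₃₁ = -2 * σ₂ * D₂ + 4 * σ₁ * (D
    * P₁) - 8 * σ₀ * P₂) (hD : D = 2 * P₁ + 4 * h₄ + 4 * h₅) (hD₂ : D₂ = (16) * h₄ * h₅ + (8) * P₁ *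
    h₅ + (8) * P₁ * h₄ + (4) * P₂) (qP₁₁ : P₁ * P₁ = 2 * P₂) (hσ₁ : σ₁ = 0) (hσ₂ : σ₂ = 4 * t - σ₀)
    (hσ₀ : σ₀ = 2 * s + 1) :
    K₃₁ = 16 * ((2) * h₄ * h₅ + (-8) * h₄ * h₅ * t + (4) * h₄ * h₅ * s + P₁ * h₅ + (-4) * P₁ * h₅ *
      t + (2) * P₁ * h₅ * s + P₁ * h₄ + (-4) * P₁ * h₄ * t + (2) * P₁ * h₄ * s + (-2) * P₂ * t) :=
      by
  linear_combination (1) * hK₃₁ + ((4) * P₁ * σ₁) * hD + ((-2) * σ₂) * hD₂ + ((8) * σ₁) * qP₁₁ +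
    ((16) * P₁ * h₅ + (16) * P₁ * h₄ + (16) * P₂) * hσ₁ + ((-32) * h₄ * h₅ + (-16) * P₁ * h₅ + (-16)
    * P₁ * h₄ + (-8) * P₂) * hσ₂ + ((32) * h₄ * h₅ + (16) * P₁ * h₅ + (16) * P₁ * h₄) * hσ₀

/-- **E, type (1,1,1,1,1,3), S = slots 0–4 (m = 1, q = 2).** Pinning: with `D = 2 * P₁ + 8 * h₅` (clique sum `P₁
= Σ_{i∈S} hᵢ` with divided powers `P₂, P₃`: `P₁P₁ = 2P₂`, `P₁P₂ = 3P₃`; outside slots square to `0`), the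
closed forms `D₂`, `D₃` below are `D^[2]`, `D^[3]`: `D·D = 2D₂` and `D·D·D = 6D₃`. -/
theorem pin_D_Km11113 (h₅ P₁ P₂ P₃ D D₂ D₃ : R) (hD : D = 2 * P₁ + 8 * h₅) (hD₂ : D₂ = (16) * P₁ *
    h₅ + (4) * P₂) (hD₃ : D₃ = (32) * P₂ * h₅ + (8) * P₃) (qP₁₁ : P₁ * P₁ = 2 * P₂) (qP₁₂ : P₁ * P₂
    = 3 * P₃) (qh₅ : h₅ * h₅ = 0) :
    D * D = 2 * D₂ ∧ D * D * D = 6 * D₃ := by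
  refine ⟨?_, ?_⟩
  · linear_combination ((8) * h₅ + (2) * P₁ + D) * hD + ((-2)) * hD₂ + (4) * qP₁₁ + (64) * qh₅
  · linear_combination ((64) * h₅ ^ 2 + (32) * P₁ * h₅ + (4) * P₁ ^ 2 + (8) * D * h₅ + (2) * D * P₁
      + D ^ 2) * hD + ((-6)) * hD₃ + ((96) * h₅ + (8) * P₁) * qP₁₁ + (16) * qP₁₂ + ((512) * h₅ +
      (384) * P₁) * qh₅

/-- **LEMMA E, type (1,1,1,1,1,3), S = slots 0–4 (m = 1, q = 2):** the same identity shape — `T₃(P₁) = 2^4·(2s +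
2u + 1 − 6t)·P₃ + 16·(outside terms)`, `v₂(T₃(P₁)) = 4 < 5`. -/
theorem T3_Km11113 (h₅ σ₀ σ₁ σ₂ σ₃ s t u P₁ P₂ P₃ D D₂ D₃ T₃ : R) (hT₃ : T₃ = σ₃ * D₃ - 2 * σ₂ * (D₂
    * P₁) + 4 * σ₁ * (D * P₂) - 8 * σ₀ * P₃) (hD : D = 2 * P₁ + 8 * h₅) (hD₂ : D₂ = (16) * P₁ * h₅ +
    (4) * P₂) (hD₃ : D₃ = (32) * P₂ * h₅ + (8) * P₃) (qP₁₁ : P₁ * P₁ = 2 * P₂) (qP₁₂ : P₁ * P₂ = 3 *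
    P₃) (hσ₁ : σ₁ = 0) (hσ₂ : σ₂ = 4 * t - σ₀) (hσ₀ : σ₀ = 2 * s + 1) (hσ₃ : σ₃ = 4 * u) :
    T₃ = 16 * ((2 * s + 2 * u + 1 - 6 * t) * P₃) + 16 * ((4) * P₂ * h₅ + (8) * P₂ * h₅ * u + (-16) *
      P₂ * h₅ * t + (8) * P₂ * h₅ * s) := by
  linear_combination (1) * hT₃ + ((4) * P₂ * σ₁) * hD + ((-2) * P₁ * σ₂) * hD₂ + (σ₃) * hD₃ + ((-32)
    * h₅ * σ₂) * qP₁₁ + ((-8) * σ₂ + (8) * σ₁) * qP₁₂ + ((32) * P₂ * h₅ + (24) * P₃) * hσ₁ + ((-64)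
    * P₂ * h₅ + (-24) * P₃) * hσ₂ + ((64) * P₂ * h₅ + (16) * P₃) * hσ₀ + ((32) * P₂ * h₅ + (8) * P₃)
    * hσ₃

/-- `K₃,₁(P₁) = 16·(explicit)` (type (1,1,1,1,1,3), S = slots 0–4 (m = 1, q = 2)); `g₃ = 5` as before. -/
theorem K31_Km11113 (h₅ σ₀ σ₁ σ₂ s t P₁ P₂ D D₂ K₃₁ : R) (hK₃₁ : K₃₁ = -2 * σ₂ * D₂ + 4 * σ₁ * (D *
    P₁) - 8 * σ₀ * P₂) (hD : D = 2 * P₁ + 8 * h₅) (hD₂ : D₂ = (16) * P₁ * h₅ + (4) * P₂) (qP₁₁ : P₁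
    * P₁ = 2 * P₂) (hσ₁ : σ₁ = 0) (hσ₂ : σ₂ = 4 * t - σ₀) (hσ₀ : σ₀ = 2 * s + 1) :
    K₃₁ = 16 * ((2) * P₁ * h₅ + (-8) * P₁ * h₅ * t + (4) * P₁ * h₅ * s + (-2) * P₂ * t) := by
  linear_combination (1) * hK₃₁ + ((4) * P₁ * σ₁) * hD + ((-2) * σ₂) * hD₂ + ((8) * σ₁) * qP₁₁ +
    ((32) * P₁ * h₅ + (16) * P₂) * hσ₁ + ((-32) * P₁ * h₅ + (-8) * P₂) * hσ₂ + ((32) * P₁ * h₅) *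
    hσ₀

/-- **E, type (1,1,1,1,1,2), S = slots 0–4 (m = 1, q = 2).** Pinning: with `D = 2 * P₁ + 4 * h₅` (clique sum `P₁
= Σ_{i∈S} hᵢ` with divided powers `P₂, P₃`: `P₁P₁ = 2P₂`, `P₁P₂ = 3P₃`; outside slots square to `0`), the
closed forms `D₂`, `D₃` below are `D^[2]`, `D^[3]`: `D·D = 2D₂` and `D·D·D = 6D₃`. -/
theorem pin_D_Km11112 (h₅ P₁ P₂ P₃ D D₂ D₃ : R) (hD : D = 2 * P₁ + 4 * h₅) (hD₂ : D₂ = (8) * P₁ * h₅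
    + (4) * P₂) (hD₃ : D₃ = (16) * P₂ * h₅ + (8) * P₃) (qP₁₁ : P₁ * P₁ = 2 * P₂) (qP₁₂ : P₁ * P₂ = 3
    * P₃) (qh₅ : h₅ * h₅ = 0) :
    D * D = 2 * D₂ ∧ D * D * D = 6 * D₃ := by
  refine ⟨?_, ?_⟩
  · linear_combination ((4) * h₅ + (2) * P₁ + D) * hD + ((-2)) * hD₂ + (4) * qP₁₁ + (16) * qh₅
  · linear_combination ((16) * h₅ ^ 2 + (16) * P₁ * h₅ + (4) * P₁ ^ 2 + (4) * D * h₅ + (2) * D * P₁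
      + D ^ 2) * hD + ((-6)) * hD₃ + ((48) * h₅ + (8) * P₁) * qP₁₁ + (16) * qP₁₂ + ((64) * h₅ + (96)
      * P₁) * qh₅

/-- **LEMMA E, type (1,1,1,1,1,2), S = slots 0–4 (m = 1, q = 2):** the same identity shape — `T₃(P₁) = 2^4·(2s +
2u + 1 − 6t)·P₃ + 16·(outside terms)`, `v₂(T₃(P₁)) = 4 < 5`. -/
theorem T3_Km11112 (h₅ σ₀ σ₁ σ₂ σ₃ s t u P₁ P₂ P₃ D D₂ D₃ T₃ : R) (hT₃ : T₃ = σ₃ * D₃ - 2 * σ₂ * (D₂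
    * P₁) + 4 * σ₁ * (D * P₂) - 8 * σ₀ * P₃) (hD : D = 2 * P₁ + 4 * h₅) (hD₂ : D₂ = (8) * P₁ * h₅ +
    (4) * P₂) (hD₃ : D₃ = (16) * P₂ * h₅ + (8) * P₃) (qP₁₁ : P₁ * P₁ = 2 * P₂) (qP₁₂ : P₁ * P₂ = 3 *
    P₃) (hσ₁ : σ₁ = 0) (hσ₂ : σ₂ = 4 * t - σ₀) (hσ₀ : σ₀ = 2 * s + 1) (hσ₃ : σ₃ = 4 * u) :
    T₃ = 16 * ((2 * s + 2 * u + 1 - 6 * t) * P₃) + 16 * ((2) * P₂ * h₅ + (4) * P₂ * h₅ * u + (-8) *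
      P₂ * h₅ * t + (4) * P₂ * h₅ * s) := by
  linear_combination (1) * hT₃ + ((4) * P₂ * σ₁) * hD + ((-2) * P₁ * σ₂) * hD₂ + (σ₃) * hD₃ + ((-16)
    * h₅ * σ₂) * qP₁₁ + ((-8) * σ₂ + (8) * σ₁) * qP₁₂ + ((16) * P₂ * h₅ + (24) * P₃) * hσ₁ + ((-32)
    * P₂ * h₅ + (-24) * P₃) * hσ₂ + ((32) * P₂ * h₅ + (16) * P₃) * hσ₀ + ((16) * P₂ * h₅ + (8) * P₃)
    * hσ₃

/-- `K₃,₁(P₁) = 16·(explicit)` (type (1,1,1,1,1,2), S = slots 0–4 (m = 1, q = 2)); `g₃ = 5` as before. -/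
theorem K31_Km11112 (h₅ σ₀ σ₁ σ₂ s t P₁ P₂ D D₂ K₃₁ : R) (hK₃₁ : K₃₁ = -2 * σ₂ * D₂ + 4 * σ₁ * (D *
    P₁) - 8 * σ₀ * P₂) (hD : D = 2 * P₁ + 4 * h₅) (hD₂ : D₂ = (8) * P₁ * h₅ + (4) * P₂) (qP₁₁ : P₁ *
    P₁ = 2 * P₂) (hσ₁ : σ₁ = 0) (hσ₂ : σ₂ = 4 * t - σ₀) (hσ₀ : σ₀ = 2 * s + 1) :
    K₃₁ = 16 * (P₁ * h₅ + (-4) * P₁ * h₅ * t + (2) * P₁ * h₅ * s + (-2) * P₂ * t) := by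
  linear_combination (1) * hK₃₁ + ((4) * P₁ * σ₁) * hD + ((-2) * σ₂) * hD₂ + ((8) * σ₁) * qP₁₁ +
    ((16) * P₁ * h₅ + (16) * P₂) * hσ₁ + ((-16) * P₁ * h₅ + (-8) * P₂) * hσ₂ + ((16) * P₁ * h₅) *
    hσ₀

/-- **E, type (1,1,1,1,1,1), S = all six slots (m = 1, q = 2).** Pinning: with `D = 2 * P₁` (clique sum `P₁ =
Σ_{i∈S} hᵢ` with divided powers `P₂, P₃`: `P₁P₁ = 2P₂`, `P₁P₂ = 3P₃`; outside slots square to `0`), the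
closed forms `D₂`, `D₃` below are `D^[2]`, `D^[3]`: `D·D = 2D₂` and `D·D·D = 6D₃`. -/
theorem pin_D_Km111111 (P₁ P₂ P₃ D D₂ D₃ : R) (hD : D = 2 * P₁) (hD₂ : D₂ = (4) * P₂) (hD₃ : D₃ =
    (8) * P₃) (qP₁₁ : P₁ * P₁ = 2 * P₂) (qP₁₂ : P₁ * P₂ = 3 * P₃) :
    D * D = 2 * D₂ ∧ D * D * D = 6 * D₃ := by
  refine ⟨?_, ?_⟩
  · linear_combination ((2) * P₁ + D) * hD + ((-2)) * hD₂ + (4) * qP₁₁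
  · linear_combination ((4) * P₁ ^ 2 + (2) * D * P₁ + D ^ 2) * hD + ((-6)) * hD₃ + ((8) * P₁) * qP₁₁
      + (16) * qP₁₂

/-- **LEMMA E, type (1,1,1,1,1,1), S = all six slots (m = 1, q = 2):** the same identity shape — `T₃(P₁) =
2^4·(2s + 2u + 1 − 6t)·P₃ + 16·(outside terms)`, `v₂(T₃(P₁)) = 4 < 5`. -/
theorem T3_Km111111 (σ₀ σ₁ σ₂ σ₃ s t u P₁ P₂ P₃ D D₂ D₃ T₃ : R) (hT₃ : T₃ = σ₃ * D₃ - 2 * σ₂ * (D₂ *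
    P₁) + 4 * σ₁ * (D * P₂) - 8 * σ₀ * P₃) (hD : D = 2 * P₁) (hD₂ : D₂ = (4) * P₂) (hD₃ : D₃ = (8) *
    P₃) (qP₁₂ : P₁ * P₂ = 3 * P₃) (hσ₁ : σ₁ = 0) (hσ₂ : σ₂ = 4 * t - σ₀) (hσ₀ : σ₀ = 2 * s + 1) (hσ₃
    : σ₃ = 4 * u) :
    T₃ = 16 * ((2 * s + 2 * u + 1 - 6 * t) * P₃) + 16 * (0) := by
  linear_combination (1) * hT₃ + ((4) * P₂ * σ₁) * hD + ((-2) * P₁ * σ₂) * hD₂ + (σ₃) * hD₃ + ((-8)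
    * σ₂ + (8) * σ₁) * qP₁₂ + ((24) * P₃) * hσ₁ + ((-24) * P₃) * hσ₂ + ((16) * P₃) * hσ₀ + ((8) *
    P₃) * hσ₃

/-- `K₃,₁(P₁) = 16·(explicit)` (type (1,1,1,1,1,1), S = all six slots (m = 1, q = 2)); `g₃ = 5` as before. -/
theorem K31_Km111111 (σ₀ σ₁ σ₂ t P₁ P₂ D D₂ K₃₁ : R) (hK₃₁ : K₃₁ = -2 * σ₂ * D₂ + 4 * σ₁ * (D * P₁)
    - 8 * σ₀ * P₂) (hD : D = 2 * P₁) (hD₂ : D₂ = (4) * P₂) (qP₁₁ : P₁ * P₁ = 2 * P₂) (hσ₁ : σ₁ = 0)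
    (hσ₂ : σ₂ = 4 * t - σ₀) :
    K₃₁ = 16 * ((-2) * P₂ * t) := by
  linear_combination (1) * hK₃₁ + ((4) * P₁ * σ₁) * hD + ((-2) * σ₂) * hD₂ + ((8) * σ₁) * qP₁₁ +
    ((16) * P₂) * hσ₁ + ((-8) * P₂) * hσ₂

end Summit.Ventures.HSemireg.CliqueUnitKills
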